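import Mathlib
import HarnessLib
import Literature.MathematicalPhysics.KineticTheory.VelocityFlipEmbeddedChainSteadyState
import Literature.MathematicalPhysics.KineticTheory.LangevinChainResolvent
import Summits.AtomisticToContinuum.FouriersLaw.Theorems.JunctionLocalitySuperadditiveResistanceStubPlainForwardFieldAux2

/-!
# The Lebesgue-transposed RESOLVENT identity of the Langevin chain (dual Kubo road: clause (iii), part 1/2)

`--supports stmt-AtomisticToContinuum-11976` helper file (crux `VanishingNoiseBound`, route
`VanishingNoiseTransfer`, line `fekete-usc-one-length`, stub S3' `stub_flipForwardFieldRegularity`, wave 4).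
Towards clause (iii) of the derivative-free hypothesis `FF''(ε)` of the dual Kubo road (`…FlipDualKuboLink`): mild
(resolvent-form) forward fields are distributional solutions. For the pinned chain `pinnedChain ω₂ lam β γ`
(`ω₂ > 0`, `lam, β, γ ≥ 0`), `N ≥ 1`, bath temperatures `T_L, T_R ≥ 0`, the resolvent kernel
`R_r = ∫₀^∞ r e^{-rt} P_t dt` (`LangevinChainSemigroup.resolventKernel` of `pinnedChainSemigroup`, `r > 0`) and the
Lebesgue transpose `ᵀL φ = L̂ φ + 2γ φ` of the generator (`L̂ = sdeGenerator (−Y) v_L v_R` the generator of the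
momentum-reversed drift):

* `pinnedChain_integral_mul_act_sub_eq_temps`, `pinnedChain_continuous_integral_mul_act_temps` — the time-integrated
  backward Dynkin identity `∫ φ (P_τ κ₀) dx − ∫ φ κ₀ dx = ∫₀^τ ∫ (ᵀLφ)(P_t κ₀) dx dt` for `φ, κ₀ ∈ C_c^∞` and the
  continuity of `t ↦ ∫ φ (P_t κ₀) dx`, at UNEQUAL temperatures (the equal-temperature statements
  `integral_mul_act_sub_eq_of_hasCompactSupport`, `continuous_integral_mul_act` of …PlainForwardFieldAux2 verbatim).
* `pinnedChain_integral_resolvent_mul_transpose_smooth` — **the transposed resolvent identity**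
  `∫ (R_r κ₀) · (r φ − ᵀLφ) dx = r ∫ φ κ₀ dx` for `φ, κ₀ ∈ C_c^∞`, i.e. `(r − L) R_r κ₀ = r κ₀` in `𝓓'`: the backward
  identity integrated against the exponential time (`integral_exp_mul_intervalIntegral_eq`, Fubini).
* `helper_flipResolventTranspose` — registered helper (notation-free restatement).

References: Ethier–Kurtz 1986 Ch. 1 §2 (resolvents); Stroock–Varadhan 1979 §3.1 (backward equation);
Haussmann–Pardoux 1986 (time reversal).
-/

noncomputable section

open MeasureTheory ProbabilityTheory Filter Topology Set
open scoped ContDiff NNReal ENNReal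
open Literature.MathematicalPhysics.KineticTheory.HeatConduction
open Literature.MathematicalPhysics.KineticTheory Literature.Probability.Process OscillatorChain
open Summit.AtomisticToContinuum.FouriersLaw.Theorems.SubdiffusiveBondHeat
open Summit.AtomisticToContinuum.FouriersLaw.Theorems.SuperadditiveResistance.PlainForwardField
  (hasCompactSupport_tensor pairAct_tensor)

namespace Summit.AtomisticToContinuum.FouriersLaw.Theorems.VanishingNoiseBound

variable {N : ℕ}

section Backward

variable {ω₂ lam β γ : ℝ} (hω : 0 < ω₂) (hl : 0 ≤ lam) (hβ : 0 ≤ β) (hγ : 0 ≤ γ) (hN : 0 < N)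
  (T_L T_R : ℝ)
include hω hl hβ hγ

/-! ## The backward Dynkin identity for tensor observables at unequal temperatures -/

include hN in
/-- **The time-integrated backward Dynkin identity for `φ ⊗ κ₀`** (`φ, κ₀ ∈ C_c^∞`, `τ ≥ 0`):
`∫ φ (P_τ κ₀) dx − ∫ φ κ₀ dx = ∫₀^τ ∫ (L̂φ + 2γφ) (P_t κ₀) dx dt`, with `L̂` the generator of the
reversed Langevin equation (`hasDerivAt_pairAct`: `d/dt ∫ φ (P_t κ₀) = ∫ (ᵗL φ)(P_t κ₀)`,
`ᵗL = L̂ − div Y = L̂ + 2γ`, and the fundamental theorem of calculus). [folklore] -/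
theorem pinnedChain_integral_mul_act_sub_eq_temps {φ κ₀ : PhaseSpace N → ℝ}
    (hφ : ContDiff ℝ ∞ φ) (hφc : HasCompactSupport φ) (hκ₀ : ContDiff ℝ ∞ κ₀)
    (hκ₀c : HasCompactSupport κ₀) {τ : ℝ} (hτ : 0 ≤ τ) :
    (∫ x, φ x * ∫ y, κ₀ y ∂((pinnedChain ω₂ lam β γ).langevinKernel N T_L T_R τ.toNNReal x)) -
        ∫ x, φ x * κ₀ x =
      ∫ t in (0 : ℝ)..τ, ∫ x,
        (sdeGenerator (fun y => -(pinnedChain ω₂ lam β γ).drift N y)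
            ((pinnedChain ω₂ lam β γ).bathVecL N T_L) ((pinnedChain ω₂ lam β γ).bathVecR N T_R) φ x +
          2 * γ * φ x) *
        ∫ y, κ₀ y ∂((pinnedChain ω₂ lam β γ).langevinKernel N T_L T_R t.toNNReal x) := by
  set P := pinnedChain ω₂ lam β γ with hPdef
  have hP : P.IsConfining := pinnedChain_isConfining hω hl hβ hγ
  have hU : ContDiff ℝ ∞ P.U := pinnedChain_contDiff_U ω₂ lam β γ
  have hV : ContDiff ℝ ∞ P.V := pinnedChain_contDiff_V ω₂ lam β γ
  haveI := isAddHaarMeasure_volume_phaseSpace N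
  set D := (hP.confinedDrift N).toConfinedDrift with hD
  have hv₁ := hP.bathVecL_mem_noise N T_L
  have hv₂ := hP.bathVecR_mem_noise N T_R
  set D' := hP.reversedDrift N with hD'
  have hv₁' := hP.bathVecL_mem_reversedDrift_noise N T_L
  have hv₂' := hP.bathVecR_mem_reversedDrift_noise N T_R
  have hY' : ∀ y, (fun y => -P.drift N y) y = -P.drift N y := fun _ => rfl
  have hdiv := P.trace_fderiv_drift hU hV hN
  have hγ' : P.γ = γ := rfl
  set Lφ := sdeGenerator (fun y => -P.drift N y) (P.bathVecL N T_L) (P.bathVecR N T_R) φ with hLφ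
  have hLφc : Continuous Lφ :=
    continuous_sdeGenerator _ _ (P.contDiff_drift hU hV N).continuous.neg (hφ.of_le (by norm_cast))
  have hLφs : HasCompactSupport Lφ := hasCompactSupport_sdeGenerator _ _ hφc
  set Θ : PhaseSpace N × PhaseSpace N → ℝ := fun p => φ p.1 * κ₀ p.2 with hΘ
  have hΘ2 : ContDiff ℝ 2 Θ :=
    ((hφ.comp contDiff_fst).mul (hκ₀.comp contDiff_snd)).of_le (by norm_cast)
  have hΘc : HasCompactSupport Θ := hasCompactSupport_tensor hφc hκ₀c
  have hφc' : Continuous φ := hφ.continuous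
  have hκ₀c' : Continuous κ₀ := hκ₀.continuous
  set Θ₁ : PhaseSpace N × PhaseSpace N → ℝ := fun p => Lφ p.1 * κ₀ p.2 with hΘ₁
  have hΘ₁c : Continuous Θ₁ := by rw [hΘ₁]; fun_prop
  have hΘ₁s : HasCompactSupport Θ₁ := hasCompactSupport_tensor hLφs hκ₀c
  have h2φs : HasCompactSupport fun x => 2 * γ * φ x := hφc.mul_left
  have hψs' : HasCompactSupport fun x => Lφ x + 2 * γ * φ x := hLφs.add h2φs
  set Θ' : PhaseSpace N × PhaseSpace N → ℝ := fun p => (Lφ p.1 + 2 * γ * φ p.1) * κ₀ p.2 with hΘ'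
  have hΘ'c : Continuous Θ' := by rw [hΘ']; fun_prop
  have hΘ's : HasCompactSupport Θ' := by rw [hΘ']; exact hasCompactSupport_tensor hψs' hκ₀c
  -- `L̂₁ Θ = L̂φ ⊗ κ₀`
  have hL1 : sdeGeneratorFst (fun y => -P.drift N y) (P.bathVecL N T_L) (P.bathVecR N T_R) Θ = Θ₁ := by
    funext p
    rw [show p = (p.1, p.2) from rfl, sdeGeneratorFst_apply]
    show sdeGenerator _ _ _ (fun x' => φ x' * κ₀ p.2) p.1 = Lφ p.1 * κ₀ p.2
    have e : (fun x' => φ x' * κ₀ p.2) = fun x' => κ₀ p.2 * φ x' := funext fun _ => mul_comm _ _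
    rw [e, sdeGenerator_const_mul _ _ _ (hφ.of_le (by norm_cast) : ContDiff ℝ 2 φ)]
    ring
  -- the derivative of the pair action
  have hder : ∀ t : ℝ, 0 < t → HasDerivAt
      (fun s : ℝ => pairAct (P.drift N) (P.bathVecL N T_L) (P.bathVecR N T_R) volume Θ s.toNNReal)
      (pairAct (P.drift N) (P.bathVecL N T_L) (P.bathVecR N T_R) volume Θ' t.toNNReal) t := by
    intro t ht
    have h := D.hasDerivAt_pairAct hv₁ hv₂ volume D' hv₁' hv₂' hY' hdiv hΘ2 hΘc ht
    rw [hL1] at h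
    have e1 : Θ' = fun p => (2 * P.γ) * Θ p + Θ₁ p := by
      funext p; simp only [hΘ', hΘ, hΘ₁, hγ']; ring
    have hΘcont : Continuous Θ := hΘ2.continuous
    have hΘ2c : Continuous fun p => (2 * P.γ) * Θ p := by fun_prop
    have e2 : -(-(2 * P.γ)) * pairAct (P.drift N) (P.bathVecL N T_L) (P.bathVecR N T_R) volume Θ t.toNNReal +
        pairAct (P.drift N) (P.bathVecL N T_L) (P.bathVecR N T_R) volume Θ₁ t.toNNReal =
        pairAct (P.drift N) (P.bathVecL N T_L) (P.bathVecR N T_R) volume Θ' t.toNNReal := by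
      have hΘ2s : HasCompactSupport fun p => (2 * P.γ) * Θ p := hΘc.mul_left
      rw [e1, D.pairAct_add hv₁ hv₂ volume hΘ2c hΘ2s hΘ₁c hΘ₁s,
        D.pairAct_const_mul hv₁ hv₂ volume hΘcont hΘc]
      ring
    rw [e2] at h
    exact h
  -- the fundamental theorem of calculus
  have hcontF : Continuous fun s : ℝ =>
      pairAct (P.drift N) (P.bathVecL N T_L) (P.bathVecR N T_R) volume Θ s.toNNReal :=
    D.continuous_pairAct hv₁ hv₂ volume hΘ2.continuous hΘc
  have hcontF' : Continuous fun s : ℝ =>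
      pairAct (P.drift N) (P.bathVecL N T_L) (P.bathVecR N T_R) volume Θ' s.toNNReal :=
    D.continuous_pairAct hv₁ hv₂ volume hΘ'c hΘ's
  have hFTC := intervalIntegral.integral_eq_sub_of_hasDerivAt_of_le hτ hcontF.continuousOn
    (fun t ht => hder t ht.1) (hcontF'.intervalIntegrable _ _)
  have h0 : pairAct (P.drift N) (P.bathVecL N T_L) (P.bathVecR N T_R) volume Θ (0 : ℝ).toNNReal =
      ∫ x, φ x * κ₀ x := by
    rw [Real.toNNReal_zero, pairAct_def]
    show ∫ x, ∫ y, Θ (x, y) ∂(P.langevinKernel N T_L T_R 0 x) = _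
    rw [hP.langevinKernel_zero N T_L T_R]
    simp [Kernel.id_apply, integral_dirac, hΘ]
  have hτ' : pairAct (P.drift N) (P.bathVecL N T_L) (P.bathVecR N T_R) volume Θ τ.toNNReal =
      ∫ x, φ x * ∫ y, κ₀ y ∂(P.langevinKernel N T_L T_R τ.toNNReal x) := pairAct_tensor P T_L T_R φ κ₀ _
  have hI : (fun t : ℝ => pairAct (P.drift N) (P.bathVecL N T_L) (P.bathVecR N T_R) volume Θ' t.toNNReal) =
      fun t => ∫ x, (Lφ x + 2 * γ * φ x) * ∫ y, κ₀ y ∂(P.langevinKernel N T_L T_R t.toNNReal x) :=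
    funext fun t => pairAct_tensor P T_L T_R (fun x => Lφ x + 2 * γ * φ x) κ₀ _
  rw [← hτ', ← h0, ← hFTC, hI]

/-- `t ↦ ∫ θ (P_{t⁺} κ₀) dx` is continuous for `θ` continuous compactly supported and `κ₀ ∈ C_c`
(`continuous_pairAct`). [folklore] -/
theorem pinnedChain_continuous_integral_mul_act_temps {θ κ₀ : PhaseSpace N → ℝ} (hθ : Continuous θ)
    (hθc : HasCompactSupport θ) (hκ₀ : Continuous κ₀) (hκ₀c : HasCompactSupport κ₀) :
    Continuous fun t : ℝ => ∫ x, θ x *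
      ∫ y, κ₀ y ∂((pinnedChain ω₂ lam β γ).langevinKernel N T_L T_R t.toNNReal x) := by
  set P := pinnedChain ω₂ lam β γ with hPdef
  have hP : P.IsConfining := pinnedChain_isConfining hω hl hβ hγ
  haveI := isAddHaarMeasure_volume_phaseSpace N
  have hΘc : Continuous fun p : PhaseSpace N × PhaseSpace N => θ p.1 * κ₀ p.2 :=
    (hθ.comp continuous_fst).mul (hκ₀.comp continuous_snd)
  have h := (hP.confinedDrift N).toConfinedDrift.continuous_pairAct (hP.bathVecL_mem_noise N T_L)
    (hP.bathVecR_mem_noise N T_R) volume hΘc (hasCompactSupport_tensor hθc hκ₀c)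
  have e : (fun s : ℝ => pairAct (P.drift N) (P.bathVecL N T_L) (P.bathVecR N T_R) volume
      (fun p : PhaseSpace N × PhaseSpace N => θ p.1 * κ₀ p.2) s.toNNReal) =
      fun t => ∫ x, θ x * ∫ y, κ₀ y ∂(P.langevinKernel N T_L T_R t.toNNReal x) :=
    funext fun s => pairAct_tensor P T_L T_R θ κ₀ _
  rwa [e] at h

end Backward

/-! ## The transposed resolvent identity -/

section Resolvent

variable {ω₂ lam β γ : ℝ} (hω : 0 < ω₂) (hl : 0 ≤ lam) (hβ : 0 ≤ β) (hγ : 0 ≤ γ) (hN : 0 < N)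
  {T_L T_R : ℝ} (hTL : 0 ≤ T_L) (hTR : 0 ≤ T_R)
include hω hl hβ hγ

/-- **The transposed resolvent identity** `∫ (R_r κ₀)(r φ − ᵀLφ) dx = r ∫ φ κ₀ dx` for `φ, κ₀ ∈ C_c^∞`, `r > 0`
(`ᵀLφ = L̂φ + 2γφ`): the time-integrated backward identity averaged over the exponential time of rate `r`. -/
theorem pinnedChain_integral_resolvent_mul_transpose_smooth {r : ℝ} (hr : 0 < r)
    {φ κ₀ : PhaseSpace N → ℝ} (hφ : ContDiff ℝ ∞ φ) (hφc : HasCompactSupport φ) (hκ₀ : ContDiff ℝ ∞ κ₀)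
    (hκ₀c : HasCompactSupport κ₀) :
    ∫ x, (∫ y, κ₀ y ∂((pinnedChainSemigroup hω hl hβ hγ hN hTL hTR).resolventKernel r x)) *
        (r * φ x - (sdeGenerator (fun y => -(pinnedChain ω₂ lam β γ).drift N y)
            ((pinnedChain ω₂ lam β γ).bathVecL N T_L) ((pinnedChain ω₂ lam β γ).bathVecR N T_R) φ x +
          2 * γ * φ x)) =
      r * ∫ x, φ x * κ₀ x := by
  set P := pinnedChain ω₂ lam β γ with hPdef
  set Sg := pinnedChainSemigroup hω hl hβ hγ hN hTL hTR with hSg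
  set R := Sg.resolventKernel r with hR
  haveI : IsMarkovKernel R := Sg.isMarkovKernel_resolventKernel hr
  haveI := isProbabilityMeasure_expMeasure hr
  set ρ := expMeasure r with hρ
  set w : PhaseSpace N → ℝ := fun x => sdeGenerator (fun y => -P.drift N y) (P.bathVecL N T_L)
    (P.bathVecR N T_R) φ x + 2 * γ * φ x with hw
  have hU : ContDiff ℝ ∞ P.U := pinnedChain_contDiff_U ω₂ lam β γ
  have hV : ContDiff ℝ ∞ P.V := pinnedChain_contDiff_V ω₂ lam β γ
  have hwc : Continuous w :=
    (continuous_sdeGenerator _ _ (P.contDiff_drift hU hV N).continuous.neg (hφ.of_le (by norm_cast))).add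
      (continuous_const.mul hφ.continuous)
  have hws : HasCompactSupport w := (hasCompactSupport_sdeGenerator _ _ hφc).add hφc.mul_left
  have hφc' : Continuous φ := hφ.continuous
  have hκc : Continuous κ₀ := hκ₀.continuous
  obtain ⟨Cκ, hCκ⟩ : ∃ C, ∀ y, ‖κ₀ y‖ ≤ C := hκc.bounded_above_of_compact_support hκ₀c
  -- the forecasts `U t x = P_{t⁺} κ₀ (x)` and their bound
  set U : ℝ → PhaseSpace N → ℝ := fun t x => ∫ y, κ₀ y ∂(Sg.kernel t.toNNReal x) with hUdef
  have hUb : ∀ t x, ‖U t x‖ ≤ Cκ := fun t x =>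
    (norm_integral_le_of_norm_le_const (Eventually.of_forall hCκ)).trans (by simp)
  have hUm : StronglyMeasurable (Function.uncurry U) :=
    hκc.stronglyMeasurable.integral_kernel (κ := Sg.timeKernel)
  -- the backward identity in `Sg.kernel` (= `transitionKernel`) form
  have hK : ∀ t : ℝ, P.langevinKernel N T_L T_R t.toNNReal = Sg.kernel t.toNNReal := fun t =>
    pinnedChain_langevinKernel_eq_transitionKernel N T_L T_R hω hl hβ hγ _
  set F : ℝ → ℝ := fun t => ∫ x, φ x * U t x with hF
  set G : ℝ → ℝ := fun t => ∫ x, w x * U t x with hG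
  have hD : ∀ τ : ℝ, 0 ≤ τ → F τ - ∫ x, φ x * κ₀ x = ∫ t in (0 : ℝ)..τ, G t := by
    intro τ hτ
    have h := pinnedChain_integral_mul_act_sub_eq_temps hω hl hβ hγ hN T_L T_R hφ hφc hκ₀ hκ₀c hτ
    rw [hK τ] at h
    have e : (∫ t in (0 : ℝ)..τ, G t) =
        ∫ t in (0 : ℝ)..τ, ∫ x, w x * ∫ y, κ₀ y ∂(P.langevinKernel N T_L T_R t.toNNReal x) := by
      refine intervalIntegral.integral_congr fun t _ => ?_
      show G t = _
      rw [hK t]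
    rw [e]
    exact h
  have hFc : Continuous F := by
    have h := pinnedChain_continuous_integral_mul_act_temps hω hl hβ hγ T_L T_R hφc' hφc hκc hκ₀c
    refine h.congr fun t => ?_
    show _ = F t
    rw [hK t]
  have hGc : Continuous G := by
    have h := pinnedChain_continuous_integral_mul_act_temps hω hl hβ hγ T_L T_R hwc hws hκc hκ₀c
    refine h.congr fun t => ?_
    show _ = G t
    rw [hK t]
  have hφi : Integrable φ := hφc'.integrable_of_hasCompactSupport hφc
  have hwi : Integrable w := hwc.integrable_of_hasCompactSupport hws
  have hGb : ∀ t, ‖G t‖ ≤ Cκ * ∫ x, ‖w x‖ := by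
    intro t
    rw [hG]
    calc ‖∫ x, w x * U t x‖ ≤ ∫ x, ‖w x‖ * Cκ := by
          refine norm_integral_le_of_norm_le (hwi.norm.mul_const _) (Eventually.of_forall fun x => ?_)
          rw [norm_mul]; exact mul_le_mul_of_nonneg_left (hUb t x) (norm_nonneg _)
      _ = Cκ * ∫ x, ‖w x‖ := by rw [integral_mul_const]; ring
  -- (1) Laplace transform of the backward identity
  have hL1 : ∫ t in Ioi 0, r * Real.exp (-(r * t)) * (F t - ∫ x, φ x * κ₀ x) =
      ∫ s in Ioi 0, Real.exp (-(r * s)) * G s := by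
    rw [← integral_exp_mul_intervalIntegral_eq hGc.measurable hGb hr]
    refine setIntegral_congr_fun measurableSet_Ioi fun t ht => ?_
    rw [hD t (le_of_lt ht)]
  -- (2) Fubini: `∫ F dExp_r = ∫ φ · R κ₀ dx`, `∫ G dExp_r = ∫ w · R κ₀ dx`
  have hfub : ∀ {a : PhaseSpace N → ℝ}, Continuous a → HasCompactSupport a →
      ∫ t, (∫ x, a x * U t x) ∂ρ = ∫ x, a x * ∫ y, κ₀ y ∂(R x) := by
    intro a ha has
    have hai : Integrable a := ha.integrable_of_hasCompactSupport has
    have hint : Integrable (Function.uncurry fun t x => a x * U t x) (ρ.prod volume) := by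
      have hdom : Integrable (fun p : ℝ × PhaseSpace N => (1 : ℝ) * (Cκ * ‖a p.2‖)) (ρ.prod volume) :=
        Integrable.mul_prod (integrable_const (1 : ℝ)) (hai.norm.const_mul Cκ)
      refine hdom.mono' ?_ (Eventually.of_forall fun p => ?_)
      · exact ((ha.comp continuous_snd).aestronglyMeasurable).mul hUm.aestronglyMeasurable
      · rcases p with ⟨t, x⟩
        simp only [Function.uncurry_apply_pair, norm_mul, one_mul]
        calc ‖a x‖ * ‖U t x‖ ≤ ‖a x‖ * Cκ := mul_le_mul_of_nonneg_left (hUb t x) (norm_nonneg _)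
          _ = Cκ * ‖a x‖ := mul_comm _ _
    rw [integral_integral_swap hint]
    refine integral_congr_ae (ae_of_all _ fun x => ?_)
    show ∫ t, a x * U t x ∂ρ = a x * ∫ y, κ₀ y ∂(R x)
    rw [integral_const_mul]
    congr 1
    rw [Sg.integral_resolventKernel hr x hκc.stronglyMeasurable hCκ]
    rfl
  have hL2 : ∫ t in Ioi 0, r * Real.exp (-(r * t)) * (F t - ∫ x, φ x * κ₀ x) =
      (∫ x, φ x * ∫ y, κ₀ y ∂(R x)) - ∫ x, φ x * κ₀ x := by
    rw [← integral_expMeasure_eq_integral_Ioi hr (fun t => F t - ∫ x, φ x * κ₀ x)]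
    have hFi : Integrable F ρ := by
      refine (integrable_const (Cκ * ∫ x, ‖φ x‖)).mono' hFc.aestronglyMeasurable (Eventually.of_forall fun t => ?_)
      rw [hF]
      calc ‖∫ x, φ x * U t x‖ ≤ ∫ x, ‖φ x‖ * Cκ := by
            refine norm_integral_le_of_norm_le (hφi.norm.mul_const _) (Eventually.of_forall fun x => ?_)
            rw [norm_mul]; exact mul_le_mul_of_nonneg_left (hUb t x) (norm_nonneg _)
        _ = Cκ * ∫ x, ‖φ x‖ := by rw [integral_mul_const]; ring
    rw [integral_sub hFi (integrable_const _), integral_const, probReal_univ, one_smul, hF]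
    show (∫ t, (∫ x, φ x * U t x) ∂ρ) - _ = _
    rw [hfub hφc' hφc]
  have hL3 : ∫ s in Ioi 0, Real.exp (-(r * s)) * G s = r⁻¹ * ∫ x, w x * ∫ y, κ₀ y ∂(R x) := by
    have e : (fun s => Real.exp (-(r * s)) * G s) = fun s => r⁻¹ * (r * Real.exp (-(r * s)) * G s) := by
      funext s; field_simp
    rw [e, integral_const_mul, ← integral_expMeasure_eq_integral_Ioi hr G, hG]
    show r⁻¹ * (∫ t, (∫ x, w x * U t x) ∂ρ) = _
    rw [hfub hwc hws]
  -- (3) assemble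
  have hkey : (∫ x, φ x * ∫ y, κ₀ y ∂(R x)) - ∫ x, φ x * κ₀ x = r⁻¹ * ∫ x, w x * ∫ y, κ₀ y ∂(R x) := by
    rw [← hL2, hL1, hL3]
  have hRm : AEStronglyMeasurable (fun x => ∫ y, κ₀ y ∂(R x)) volume :=
    (hκc.stronglyMeasurable.integral_kernel (κ := R)).aestronglyMeasurable
  have hRb : ∀ x, ‖∫ y, κ₀ y ∂(R x)‖ ≤ Cκ := fun x =>
    (norm_integral_le_of_norm_le_const (Eventually.of_forall hCκ)).trans (by simp)
  have hI1 : Integrable (fun x => (∫ y, κ₀ y ∂(R x)) * (r * φ x)) := by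
    refine ((hφi.const_mul r).norm.const_mul Cκ).mono' (hRm.mul (by fun_prop)) (Eventually.of_forall fun x => ?_)
    rw [norm_mul]
    exact mul_le_mul_of_nonneg_right (hRb x) (norm_nonneg _) |>.trans (le_of_eq (by ring))
  have hI2 : Integrable (fun x => (∫ y, κ₀ y ∂(R x)) * w x) := by
    refine (hwi.norm.const_mul Cκ).mono' (hRm.mul hwc.aestronglyMeasurable) (Eventually.of_forall fun x => ?_)
    rw [norm_mul]
    exact mul_le_mul_of_nonneg_right (hRb x) (norm_nonneg _) |>.trans (le_of_eq (by ring))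
  have e1 : (fun x => (∫ y, κ₀ y ∂(R x)) * (r * φ x - w x)) =
      fun x => (∫ y, κ₀ y ∂(R x)) * (r * φ x) - (∫ y, κ₀ y ∂(R x)) * w x := by
    funext x; ring
  rw [e1, integral_sub hI1 hI2]
  have e2 : ∫ x, (∫ y, κ₀ y ∂(R x)) * (r * φ x) = r * ∫ x, φ x * ∫ y, κ₀ y ∂(R x) := by
    rw [← integral_const_mul]
    exact integral_congr_ae (ae_of_all _ fun x => by ring)
  have e3 : ∫ x, (∫ y, κ₀ y ∂(R x)) * w x = ∫ x, w x * ∫ y, κ₀ y ∂(R x) :=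
    integral_congr_ae (ae_of_all _ fun x => by ring)
  rw [e2, e3]
  have hr0 : r ≠ 0 := hr.ne'
  have := hkey
  field_simp at this
  linarith [this]

end Resolvent

/-! ## Registered helper -/

/-- Registered helper sub-goal `helper_flipResolventTranspose` of stub `stub_flipForwardFieldRegularity` (line
`fekete-usc-one-length`, crux stmt-AtomisticToContinuum-11976): the transposed resolvent identity of the Langevin chain
on `C_c^∞` (`pinnedChain_integral_resolvent_mul_transpose_smooth`). -/
theorem helper_flipResolventTranspose : ∀ (ω₂ lam β γ : ℝ) (hω : 0 < ω₂) (hl : 0 ≤ lam) (hβ : 0 ≤ β) (hγ : 0 ≤ γ) (N : ℕ) (hN : 0 < N) (T_L T_R : ℝ) (hTL : 0 ≤ T_L) (hTR : 0 ≤ T_R) (r : ℝ), 0 < r → ∀ (φ κ₀ : Literature.MathematicalPhysics.KineticTheory.HeatConduction.PhaseSpace N → ℝ), ContDiff ℝ ((⊤ : ℕ∞) : WithTop ℕ∞) φ → HasCompactSupport φ → ContDiff ℝ ((⊤ : ℕ∞) : WithTop ℕ∞) κ₀ → HasCompactSupport κ₀ → MeasureTheory.integral MeasureTheory.volume (fun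 x => MeasureTheory.integral ((Literature.MathematicalPhysics.KineticTheory.HeatConduction.pinnedChainSemigroup hω hl hβ hγ hN hTL hTR).resolventKernel r x) (fun y => κ₀ y) * (r * φ x - (Literature.MathematicalPhysics.KineticTheory.sdeGenerator (fun y => -((Literature.MathematicalPhysics.KineticTheory.HeatConduction.pinnedChain ω₂ lam β γ).drift N y)) ((Literature.MathematicalPhysics.KineticTheory.HeatConduction.pinnedChain ω₂ lam β γ).bathVecL N T_L) ((Literature.MathematicalPhysics.KineticTheory.HeatConduction.pinnedChain ω₂ lam β γ).bathVecR N T_R) φ x + 2 * γ * φ x))) = r * MeasureTheory.integral MeasureTheory.volume (fun x => φ x * κ₀ x) :=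
  fun _ _ _ _ hω hl hβ hγ _ hN _ _ hTL hTR _ hr _ _ hφ hφc hκ₀ hκ₀c =>
    pinnedChain_integral_resolvent_mul_transpose_smooth hω hl hβ hγ hN hTL hTR hr hφ hφc hκ₀ hκ₀c

end Summit.AtomisticToContinuum.FouriersLaw.Theorems.VanishingNoiseBound

end
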